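/-
Copyright (c) 2026 the pub-hodgecm-mathlib formalisation cell (harness21).  Prover seat hodgecm-mathlib-LH7-p09 (g2), CLOSE-OUT ROSTER strike line L3∕L5 (Track A
«(D-RAM) FOUR-FRAME» squad F0∕P3c∕LH4 ∕ F0∕P3c∕LH7); β₂-BOARD row (L-P) «populated ∕ unlabelled cells pay 0» (lineage LH7-p09), the OFF-ROW half asked by the β₂ sub-dealer
LH4-p04 (g9) (L-Σ-3B) ED. 2 «OFF-ROW ZERO» (this seat's cone-cell census 22:37:23Z); helper lane on h413 = stmt-HodgeConjecture-24833 (count-neutral).  2026-09-04.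
-/
import Summits.HodgeConjecture.HodgeConjecture.Theorems.F0P3cDyRamTerminalCellOffShellCardTwo   -- ★ p862572 (this seat): the `Fix ρ`-coordinates `mul_map_sub_mul_map_eq`; brings ★ `…ShellLineModel`, ★ p862037 transports, ★ p861810 `v_map_le_map_pow_of_le`
import HarnessLib

/-!
# Crux `H413`, line LH4 «(D-RAM) FOUR-FRAME» — the (β₂) road (R-36) «PURE-CELL LEDGER», row (L-P) ∕ (L-Σ-3B) ED. 2 «OFF-ROW ZERO»: «A DEEP CONE CELL IS OFF THE SHELL» — strictly
# below the row (`|μ| ≤ |ϖE|^{2b+1}`) and strictly inside the anti-diagonal (`|μ − ρμ| ≤ |cc(α − ρα)|·|ϖE|^{b+1}`) EVERY glued vertex has `(Γ − 1)·L ⊆ ϖ·L` (any `q`, any `d`)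

Cell `hodgecm-mathlib` (D-0151), FLOOR 0, crux item H413 = `stmt-HodgeConjecture-24833`, route of record `HCCMUnconditional`; squads F0∕P3c∕LH4 ∕ LH7; lane
`--supports stmt-HodgeConjecture-24833 --as helper` (count-neutral; pays NO tier-0 row).  THEOREMS ONLY (no `def`, no instance, no notation, no `sorry`, default heartbeats);
★-only imports; states NO law; (β₂) stays a HYPOTHESIS.  DATUM-FREE: plane field `E` with `|ϖ| = exp(−1)`, line model `(M, jE, ρ, α)` (`ρ` isometric, `ρα ≠ α`, `|α| ≤ 1`,
`ρ` fixes `jE(E)`), a glued vertex `L` with tube `b` over `Λ = φ(B₂) = x₀·𝒪_cc`, `φ w₀ = Y⁻¹x₀` (★ `…ShellLineModel` letters VERBATIM).  NO residue-field hypothesis.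

WHY (this seat's CONE-CELL CENSUS for LH4-p04 (g9)'s ED. 2, squad bus 22:37:23Z).  In the `Fix ρ`-coordinates of ★ p862572 (`μ = A + B·α`, `Y = P + Q·α`,
`(μ∕Y − ρ(μ∕Y))·Y·ρY = (BP − AQ)(α − ρα)`) the depth clause of the cone cell `(j, b)` reads `|BP − AQ| ≤ |ϖE|^{j+2b}` and LEVEL ≥ 1 of `Γ − 1` on a glued vertex reads
`|BP − AQ| ≤ |ϖE|^{j+2b+1}` (the third clause of ★ `…ShellLineModel.latticeInLevel_endoGL_sub_one_iff_isOrd` at `ℓ = 1`).  With `m₀ = v(μ)`, `jl′ = v(μ − ρμ) − v(α − ρα)` one has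
`|BP| ≤ |ϖE|^{jl′ + b}`, `|AQ| ≤ |ϖE|^{m₀ + j}` — so on the DEEP cells (`2b < m₀` AND `j + b < jl′`) BOTH terms are already one digit inside: every glued vertex sits on level `≥ 1`,
hence on NO `ℓ₀ = 0` shell, and the cell pays `0` to ★ p861305's labelled difference (both `Q₊`, `Q₋` false; ★ p861332 `natCast_finsum_sub_eq_zero_of_forall_not`).  The populated
labelled cells of the engines (LH4-cdis1 `CELLCHECK.out`, every key) lie exactly on the three complementary lines ROW `2b = m₀`, LOWER ANTI-DIAGONAL `j + b = jl′`, UPPER LINE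
`j − b = jl′ − m₀`; this file is the q-FREE half of «OFF-ROW ZERO» (the FAR cells — depth fails, `levelSetDep = ∅` — are the sibling file).
* §1 `v_div_sub_map_div_le_of_deep` — `|μ| ≤ |ϖE|^{2b+1}`, `|μ − ρμ| ≤ |cc(α − ρα)|·|ϖE|^{b+1}`, `Y ∈ 𝒪_cc`, `|Y| = |ϖE|^b`, `|cc| ≤ |ϖE|^b` ⇒ `|μ∕Y − ρ(μ∕Y)| ≤ |cc(α − ρα)|·|ϖE|`;
  `isOrd_div_mul_of_deep` — `IsOrd cc (μ∕(ϖE·Y))`.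
* §2 HEAD `latticeInLevel_one_endoGL_sub_one_of_deep` (`LatticeInLevel ϖ 1 (Γ − 1) L`) and `not_latticeNearTransvShell_zero_of_deep` (`¬ LatticeNearTransvShell ϖ 0 mc (Γ − 1) L`).
WHAT IS NOT CLAIMED.  The three live lines (ROW: ★ p861810 ∕ p862037 ∕ p862103 ∕ p862572; LOWER∕UPPER: balanced in every engine table — the ε-exchange road ★ p862261, NOT this
file); `d` odd shells `ℓ₀ = 1` (level `≥ 1 = ℓ₀` is not enough there); any census law.
HONEST LABEL.  Count-neutral valuation algebra; nothing printed is asserted; `HC_CM` is proved only modulo the 7 printed citations (2 remaining named inputs: hLiu418 =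
`stmt-HodgeConjecture-24832`, h413 = `stmt-HodgeConjecture-24833`) until rung 0 closes.
## References
* [Serre1979] J.-P. Serre, *Local Fields*, GTM 67 (1979): Ch. III §6 Prop. 12 (orders of conductor `c`).
* [Kottwitz1986BaseChangeUnits] R. E. Kottwitz, *Base change for unit elements of Hecke algebras*, Compositio Math. 60 (1986): §1 pp. 240–241, §3 (congruence levels on lattices).
* [Jacobowitz1962] R. Jacobowitz, *Hermitian forms over local fields*, Amer. J. Math. 84 (1962): §4 (duals, gluing).
* [Rogawski1990] J. D. Rogawski, *Automorphic Representations of Unitary Groups in Three Variables*, Ann. of Math. Stud. 123 (1990): §4.9 Prop. 4.9.1 (b) p. 55.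
-/

set_option autoImplicit false

noncomputable section

namespace Summit.HodgeConjecture.HodgeConjecture.Cruxes.H413.F0P3cDyRamDeepConeCellOffShell

open scoped Valued WithZero Matrix MatrixGroups
open WithZero
open Literature.NumberTheory.Automorphic Literature.NumberTheory.Automorphic.HermitianLattice Literature.NumberTheory.Automorphic.UnitaryLatticeTree
open Literature.NumberTheory.Rogawski1990
open Summit.HodgeConjecture.HodgeConjecture.Cruxes.H413.F0P3cDyRamToricCensusDefs
open Summit.HodgeConjecture.HodgeConjecture.Cruxes.H413.F0P3cDyRamFourFrameCensusDefs (LatticeInLevel LatticeNearTransvShell)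
open Summit.HodgeConjecture.HodgeConjecture.Cruxes.H413.F0P3cDyRamShellLineModel (latticeInLevel_endoGL_sub_one_iff_isOrd)
open Summit.HodgeConjecture.HodgeConjecture.Cruxes.H413.F0P3cDyRamBoundaryCellLetterCardTwo (v_map_lt_one_iff_of_le_iff)
open Summit.HodgeConjecture.HodgeConjecture.Cruxes.H413.F0P3cDyRamRayDominatedCellLetter (v_map_le_map_pow_of_le)
open Summit.HodgeConjecture.HodgeConjecture.Cruxes.H413.F0P3cDyRamTerminalCellOffShellCardTwo (mul_map_sub_mul_map_eq)

variable {E M : Type} [Field E] [Valued E ℤᵐ⁰] [Field M] [Valued M ℤᵐ⁰] {ρ : M →+* M} {α : M}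

/-! ## §1 The deep cell: the depth quotient lies ONE DIGIT inside the order, for every `Y` of the cell -/

/-- **THE DEEP DIGIT (any `q`).**  Line model: `ρ` isometric, `ρα ≠ α`, `|α| ≤ 1`, `ρ(ϖE) = ϖE`, `|ϖ| = exp(−1)`, `|jE c| ≤ 1 ↔ |c| ≤ 1`.  CELL: `Y ∈ 𝒪_cc`, `|Y| = |ϖE|^b`,
`|cc| ≤ |ϖE|^b`.  DEEP letters: `|μ| ≤ |ϖE|^{2b+1}` (strictly below the row) and `|μ − ρμ| ≤ |cc(α − ρα)|·|ϖE|^{b+1}` (strictly inside the anti-diagonal).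
THEN `|μ∕Y − ρ(μ∕Y)| ≤ |cc(α − ρα)|·|ϖE|`. [cite: Serre1979, Ch. III §6 Prop. 12] [cite: Kottwitz1986BaseChangeUnits, §1 pp. 240–241] -/
theorem v_div_sub_map_div_le_of_deep
    (hvρ : ∀ x, Valued.v (ρ x) = Valued.v x) (hα : ρ α ≠ α) (hα1 : Valued.v α ≤ 1)
    (jE : E →+* M) (hjv : ∀ c, Valued.v (jE c) ≤ 1 ↔ Valued.v c ≤ 1) {ϖ : E} (hϖ : Valued.v ϖ = exp (-1 : ℤ))
    {cc : M} {Y : M} (hYO : IsOrd ρ α cc Y) {b : ℕ} (hYb : Valued.v Y = Valued.v (jE ϖ) ^ b) (hcb : Valued.v cc ≤ Valued.v (jE ϖ) ^ b)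
    {μ : M} (hμ : Valued.v μ ≤ Valued.v (jE ϖ) ^ (2 * b + 1)) (hanti : Valued.v (μ - ρ μ) ≤ Valued.v (cc * (α - ρ α)) * Valued.v (jE ϖ) ^ (b + 1)) :
    Valued.v (μ / Y - ρ (μ / Y)) ≤ Valued.v (cc * (α - ρ α)) * Valued.v (jE ϖ) := by
  have hα0 : α - ρ α ≠ 0 := sub_ne_zero.2 (Ne.symm hα)
  have hvα0 : Valued.v (α - ρ α) ≠ 0 := (Valuation.ne_zero_iff _).2 hα0
  have hvαpos : 0 < Valued.v (α - ρ α) := zero_lt_iff.2 hvα0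
  have hvϖ0 : Valued.v ϖ ≠ 0 := by rw [hϖ]; exact exp_ne_zero
  have hϖ0 : ϖ ≠ 0 := fun h0 => hvϖ0 (by rw [h0, map_zero])
  have hϖlt : Valued.v ϖ < 1 := by rw [hϖ, ← exp_zero, exp_lt_exp]; norm_num
  have hjϖ0 : jE ϖ ≠ 0 := (map_ne_zero jE).2 hϖ0
  have hvjϖ0 : Valued.v (jE ϖ) ≠ 0 := (Valuation.ne_zero_iff _).2 hjϖ0
  have hvjϖpos : 0 < Valued.v (jE ϖ) := zero_lt_iff.2 hvjϖ0
  have hjϖle : Valued.v (jE ϖ) ≤ 1 := ((v_map_lt_one_iff_of_le_iff jE hjv ϖ).2 hϖlt).le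
  have hY0 : Y ≠ 0 := fun h0 => by
    rw [h0, Valuation.map_zero] at hYb
    exact pow_ne_zero b hvjϖ0 hYb.symm
  have hρY0 : ρ Y ≠ 0 := (map_ne_zero ρ).2 hY0
  -- coordinates over `Fix ρ` (no fixedness is used: sizes only)
  set B : M := (μ - ρ μ) / (α - ρ α) with hBdef
  set Q : M := (Y - ρ Y) / (α - ρ α) with hQdef
  set A : M := μ - B * α with hAdef
  set P : M := Y - Q * α with hPdef
  clear_value A P
  clear_value B Q
  -- sizes
  have hvB : Valued.v B ≤ Valued.v cc * Valued.v (jE ϖ) ^ (b + 1) := by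
    rw [hBdef, Valuation.map_div, div_le_iff₀ hvαpos]
    calc Valued.v (μ - ρ μ) ≤ Valued.v (cc * (α - ρ α)) * Valued.v (jE ϖ) ^ (b + 1) := hanti
      _ = Valued.v cc * Valued.v (jE ϖ) ^ (b + 1) * Valued.v (α - ρ α) := by rw [Valuation.map_mul]; ac_rfl
  have hvQ : Valued.v Q ≤ Valued.v cc := by
    rw [hQdef, Valuation.map_div, div_le_iff₀ hvαpos, ← Valuation.map_mul]
    exact hYO.2
  have hvP : Valued.v P ≤ Valued.v (jE ϖ) ^ b := by
    rw [hPdef]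
    refine (Valuation.map_sub _ _ _).trans (max_le hYb.le ?_)
    rw [Valuation.map_mul]
    calc Valued.v Q * Valued.v α ≤ Valued.v cc * 1 := mul_le_mul' hvQ hα1
      _ = Valued.v cc := mul_one _
      _ ≤ Valued.v (jE ϖ) ^ b := hcb
  have hvA : Valued.v A ≤ Valued.v (jE ϖ) ^ (2 * b + 1) := by
    rw [hAdef]
    refine (Valuation.map_sub _ _ _).trans (max_le hμ ?_)
    rw [Valuation.map_mul]
    calc Valued.v B * Valued.v α ≤ Valued.v cc * Valued.v (jE ϖ) ^ (b + 1) * 1 := mul_le_mul' hvB hα1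
      _ = Valued.v cc * Valued.v (jE ϖ) ^ (b + 1) := mul_one _
      _ ≤ Valued.v (jE ϖ) ^ b * Valued.v (jE ϖ) ^ (b + 1) := mul_le_mul_left hcb _
      _ = Valued.v (jE ϖ) ^ (2 * b + 1) := by rw [← pow_add]; congr 1; omega
  -- `|BP − AQ| ≤ |cc|·|ϖE|^{2b+1}`
  have hBP : Valued.v (B * P) ≤ Valued.v cc * Valued.v (jE ϖ) ^ (2 * b + 1) := by
    rw [Valuation.map_mul]
    calc Valued.v B * Valued.v P ≤ Valued.v cc * Valued.v (jE ϖ) ^ (b + 1) * Valued.v (jE ϖ) ^ b := mul_le_mul' hvB hvP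
      _ = Valued.v cc * Valued.v (jE ϖ) ^ (2 * b + 1) := by rw [mul_assoc, ← pow_add]; congr 2; omega
  have hAQ : Valued.v (A * Q) ≤ Valued.v cc * Valued.v (jE ϖ) ^ (2 * b + 1) := by
    rw [Valuation.map_mul, mul_comm]
    exact mul_le_mul' hvQ hvA
  have hdiff : Valued.v (B * P - A * Q) ≤ Valued.v cc * Valued.v (jE ϖ) ^ (2 * b + 1) :=
    (Valuation.map_sub _ _ _).trans (max_le hBP hAQ)
  -- conclude through the coordinate identity
  have hident : μ / Y - ρ (μ / Y) = (B * P - A * Q) * (α - ρ α) / (Y * ρ Y) := by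
    rw [map_div₀, div_sub_div _ _ hY0 hρY0, mul_map_sub_mul_map_eq hα hBdef hAdef hQdef hPdef]
  rw [hident, Valuation.map_div, Valuation.map_mul, Valuation.map_mul, hvρ, hYb,
    div_le_iff₀ (mul_pos (pow_pos hvjϖpos _) (pow_pos hvjϖpos _))]
  calc Valued.v (B * P - A * Q) * Valued.v (α - ρ α)
      ≤ Valued.v cc * Valued.v (jE ϖ) ^ (2 * b + 1) * Valued.v (α - ρ α) := mul_le_mul_left hdiff _
    _ = Valued.v (cc * (α - ρ α)) * Valued.v (jE ϖ) * (Valued.v (jE ϖ) ^ b * Valued.v (jE ϖ) ^ b) := by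
          rw [Valuation.map_mul, pow_succ, two_mul, pow_add]; ac_rfl

/-- **THE DEEP CELL'S DEPTH QUOTIENT LIES ONE DIGIT INSIDE THE ORDER**: under the letters of `v_div_sub_map_div_le_of_deep`, `IsOrd ρ α cc (μ ∕ (ϖE·Y))` — the third clause of
★ `…ShellLineModel.latticeInLevel_endoGL_sub_one_iff_isOrd` at level `1`. [cite: Serre1979, Ch. III §6 Prop. 12] [cite: Kottwitz1986BaseChangeUnits, §3] -/
theorem isOrd_div_mul_of_deep
    (hvρ : ∀ x, Valued.v (ρ x) = Valued.v x) (hα : ρ α ≠ α) (hα1 : Valued.v α ≤ 1)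
    (jE : E →+* M) (hjv : ∀ c, Valued.v (jE c) ≤ 1 ↔ Valued.v c ≤ 1) {ϖ : E} (hϖ : Valued.v ϖ = exp (-1 : ℤ)) (hρϖ : ρ (jE ϖ) = jE ϖ)
    {cc : M} {Y : M} (hYO : IsOrd ρ α cc Y) {b : ℕ} (hYb : Valued.v Y = Valued.v (jE ϖ) ^ b) (hcb : Valued.v cc ≤ Valued.v (jE ϖ) ^ b)
    {μ : M} (hμ : Valued.v μ ≤ Valued.v (jE ϖ) ^ (2 * b + 1)) (hanti : Valued.v (μ - ρ μ) ≤ Valued.v (cc * (α - ρ α)) * Valued.v (jE ϖ) ^ (b + 1)) :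
    IsOrd ρ α cc (μ / (jE ϖ * Y)) := by
  have key := v_div_sub_map_div_le_of_deep hvρ hα hα1 jE hjv hϖ hYO hYb hcb hμ hanti
  have hvϖ0 : Valued.v ϖ ≠ 0 := by rw [hϖ]; exact exp_ne_zero
  have hϖ0 : ϖ ≠ 0 := fun h0 => hvϖ0 (by rw [h0, map_zero])
  have hϖlt : Valued.v ϖ < 1 := by rw [hϖ, ← exp_zero, exp_lt_exp]; norm_num
  have hjϖ0 : jE ϖ ≠ 0 := (map_ne_zero jE).2 hϖ0
  have hvjϖ0 : Valued.v (jE ϖ) ≠ 0 := (Valuation.ne_zero_iff _).2 hjϖ0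
  have hvjϖpos : 0 < Valued.v (jE ϖ) := zero_lt_iff.2 hvjϖ0
  have hjϖle : Valued.v (jE ϖ) ≤ 1 := ((v_map_lt_one_iff_of_le_iff jE hjv ϖ).2 hϖlt).le
  have hY0 : Y ≠ 0 := fun h0 => by
    rw [h0, Valuation.map_zero] at hYb
    exact pow_ne_zero b hvjϖ0 hYb.symm
  have hρY0 : ρ Y ≠ 0 := (map_ne_zero ρ).2 hY0
  refine ⟨?_, ?_⟩
  · rw [Valuation.map_div, Valuation.map_mul, hYb, div_le_one₀ (mul_pos hvjϖpos (pow_pos hvjϖpos _)), ← pow_succ']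
    exact hμ.trans (pow_le_pow_right_of_le_one' hjϖle (by omega))
  · have e : μ / (jE ϖ * Y) - ρ (μ / (jE ϖ * Y)) = (μ / Y - ρ (μ / Y)) / jE ϖ := by
      rw [map_div₀, map_div₀, map_mul, hρϖ]
      field_simp
    rw [e, Valuation.map_div, div_le_iff₀ hvjϖpos]
    exact key

/-! ## §2 HEAD — every glued vertex over a deep cell is on level `1`, hence on no `ℓ₀ = 0` shell -/

/-- **HEAD — «A DEEP CONE CELL IS OFF THE SHELL», LEVEL FORM (any `q`).**  Frame: ★ `…ShellLineModel.latticeInLevel_endoGL_sub_one_iff_isOrd`'s glued-vertex letters VERBATIM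
(plane `E`, `|ϖ| = exp(−1)`, line model `(M, jE, ρ, α; φ, lam)` with `Fix ρ ⊇ jE(E)` (`hjfix`), vertex `L` with tube `b` over `(B₂, w₀, g₀)`, `Λ = φ(B₂) = x₀·𝒪_cc`, `φ w₀ = Y⁻¹x₀`);
CELL `hYO hYb hcb` (`cc = ϖE^j`, `j ≥ b`); the literal's `hum : |u₀₀ − 1| ≤ |ϖ^m|`, `1 ≤ m`; DEEP letters `hμ : |lam − jE u₀₀| ≤ |ϖE|^{2b+1}` (`2b < m₀`) and
`hanti : |μ − ρμ| ≤ |cc(α − ρα)|·|ϖE|^{b+1}` (`j + b < jl′`).  THEN `LatticeInLevel ϖ 1 (Γ − 1) L`, `Γ = endoGL (γ₂, u)`.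
[cite: Kottwitz1986BaseChangeUnits, §3] [cite: Serre1979, Ch. III §6 Prop. 12] [cite: Jacobowitz1962, §4] -/
theorem latticeInLevel_one_endoGL_sub_one_of_deep
    (hvρ : ∀ x, Valued.v (ρ x) = Valued.v x) (hα : ρ α ≠ α) (hα1 : Valued.v α ≤ 1)
    {ϖ : E} (hϖ : Valued.v ϖ = exp (-1 : ℤ))
    (jE : E →+* M) (hjv : ∀ c, Valued.v (jE c) ≤ 1 ↔ Valued.v c ≤ 1) (hjfix : ∀ z, ρ z = z ↔ ∃ c, jE c = z)
    (φ : (Fin 2 → E) →+ M) (hφs : ∀ (c : E) (x : Fin 2 → E), φ (c • x) = jE c * φ x) (hφi : Function.Injective φ)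
    {γ₂ : GL (Fin 2) E} {lam : M} (hφγ : ∀ x, φ ((γ₂ : Matrix (Fin 2) (Fin 2) E) *ᵥ x) = lam * φ x)
    {L : Submodule 𝒪[E] (Fin 3 → E)} {b : ℕ} (hb : ∀ a : E, (Pi.single 1 a : Fin 3 → E) ∈ L ↔ Valued.v a ≤ Valued.v ϖ ^ b)
    (hpr : ∀ x ∈ L, Valued.v (x 1) * Valued.v ϖ ^ b ≤ 1)
    {B₂ : Submodule 𝒪[E] (Fin 2 → E)} {w₀ : Fin 2 → E} {g₀ : Fin 3 → E}
    (hB : B₂.map ((Matrix.toLin' (!![1, 0; 0, 0; 0, 1] : Matrix (Fin 3) (Fin 2) E)).restrictScalars 𝒪[E]) =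
      L ⊓ LinearMap.ker ((LinearMap.proj (1 : Fin 3) : (Fin 3 → E) →ₗ[E] E).restrictScalars 𝒪[E]))
    (hg₀ : g₀ ∈ L) (hg₀1 : Valued.v (g₀ 1) * Valued.v ϖ ^ b = 1) (hprg : g₀ - Pi.single 1 (g₀ 1) = ![w₀ 0, 0, w₀ 1])
    {Λ : AddSubgroup M} (hBΛ : B₂.toAddSubgroup.map φ = Λ) {cc x₀ Y : M} (hx₀ : x₀ ≠ 0)
    (hΛx : ∀ x, x ∈ Λ ↔ ∃ z, IsOrd ρ α cc z ∧ x = x₀ * z) (hw₀Y : φ w₀ = Y⁻¹ * x₀)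
    (hYO : IsOrd ρ α cc Y) (hYb : Valued.v Y = Valued.v (jE ϖ) ^ b) (hcb : Valued.v cc ≤ Valued.v (jE ϖ) ^ b)
    (u : GL (Fin 1) E) {m : ℕ} (hm1 : 1 ≤ m) (hum : Valued.v ((u : Matrix (Fin 1) (Fin 1) E) 0 0 - 1) ≤ Valued.v (ϖ ^ m))
    (hμ : Valued.v (lam - jE ((u : Matrix (Fin 1) (Fin 1) E) 0 0)) ≤ Valued.v (jE ϖ) ^ (2 * b + 1))
    (hanti : Valued.v ((lam - jE ((u : Matrix (Fin 1) (Fin 1) E) 0 0)) - ρ (lam - jE ((u : Matrix (Fin 1) (Fin 1) E) 0 0))) ≤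
      Valued.v (cc * (α - ρ α)) * Valued.v (jE ϖ) ^ (b + 1)) :
    LatticeInLevel ϖ 1 ((((endoGL (γ₂, u) : GL (Fin 3) E) : Matrix (Fin 3) (Fin 3) E) - 1)) L := by
  have hvϖ0 : Valued.v ϖ ≠ 0 := by rw [hϖ]; exact exp_ne_zero
  have hϖ0 : ϖ ≠ 0 := fun h0 => hvϖ0 (by rw [h0, map_zero])
  have hϖlt : Valued.v ϖ < 1 := by rw [hϖ, ← exp_zero, exp_lt_exp]; norm_num
  have hjϖ0 : jE ϖ ≠ 0 := (map_ne_zero jE).2 hϖ0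
  have hvjϖ0 : Valued.v (jE ϖ) ≠ 0 := (Valuation.ne_zero_iff _).2 hjϖ0
  have hvjϖpos : 0 < Valued.v (jE ϖ) := zero_lt_iff.2 hvjϖ0
  have hjϖle : Valued.v (jE ϖ) ≤ 1 := ((v_map_lt_one_iff_of_le_iff jE hjv ϖ).2 hϖlt).le
  have hρϖ : ρ (jE ϖ) = jE ϖ := (hjfix _).2 ⟨ϖ, rfl⟩
  have hY0 : Y ≠ 0 := fun h0 => by
    rw [h0, Valuation.map_zero] at hYb
    exact pow_ne_zero b hvjϖ0 hYb.symm
  -- the literal's `u`-part is `ϖ`-close to `1`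
  have hum1 : Valued.v ((u : Matrix (Fin 1) (Fin 1) E) 0 0 - 1) ≤ Valued.v ϖ ^ 1 :=
    hum.trans (by rw [Valuation.map_pow]; exact pow_le_pow_right_of_le_one' hϖlt.le hm1)
  have hjum : Valued.v (jE ((u : Matrix (Fin 1) (Fin 1) E) 0 0) - 1) ≤ Valued.v (jE ϖ) := by
    have h := v_map_le_map_pow_of_le jE hjv hϖ0 hum1
    rwa [pow_one, map_sub, map_one] at h
  -- `|μ| ≤ |ϖE|`, `|μ − ρμ| ≤ |cc(α − ρα)|·|ϖE|`
  have hμle : Valued.v (lam - jE ((u : Matrix (Fin 1) (Fin 1) E) 0 0)) ≤ Valued.v (jE ϖ) :=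
    hμ.trans (by
      calc Valued.v (jE ϖ) ^ (2 * b + 1) ≤ Valued.v (jE ϖ) ^ 1 := pow_le_pow_right_of_le_one' hjϖle (by omega)
        _ = Valued.v (jE ϖ) := pow_one _)
  have hantile : Valued.v ((lam - jE ((u : Matrix (Fin 1) (Fin 1) E) 0 0)) - ρ (lam - jE ((u : Matrix (Fin 1) (Fin 1) E) 0 0))) ≤
      Valued.v (cc * (α - ρ α)) * Valued.v (jE ϖ) :=
    hanti.trans (mul_le_mul_right (by
      calc Valued.v (jE ϖ) ^ (b + 1) ≤ Valued.v (jE ϖ) ^ 1 := pow_le_pow_right_of_le_one' hjϖle (by omega)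
        _ = Valued.v (jE ϖ) := pow_one _) _)
  rw [latticeInLevel_endoGL_sub_one_iff_isOrd hvρ hϖ jE φ hφs hφi hφγ hb hpr hB hg₀ hg₀1 hprg hBΛ hx₀ hY0 hΛx hw₀Y u 1, pow_one, pow_one]
  refine ⟨hum1.trans (le_of_eq (pow_one _)), ?_, ?_⟩
  · -- `IsOrd cc ((lam − 1)∕ϖE)`
    have hρu : ρ (jE ((u : Matrix (Fin 1) (Fin 1) E) 0 0)) = jE ((u : Matrix (Fin 1) (Fin 1) E) 0 0) := (hjfix _).2 ⟨_, rfl⟩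
    have hsplit : lam - 1 = (lam - jE ((u : Matrix (Fin 1) (Fin 1) E) 0 0)) + (jE ((u : Matrix (Fin 1) (Fin 1) E) 0 0) - 1) := by ring
    refine ⟨?_, ?_⟩
    · rw [Valuation.map_div, div_le_one₀ hvjϖpos, hsplit]
      exact (Valuation.map_add _ _ _).trans (max_le hμle hjum)
    · have e : (lam - 1) / jE ϖ - ρ ((lam - 1) / jE ϖ) =
          ((lam - jE ((u : Matrix (Fin 1) (Fin 1) E) 0 0)) - ρ (lam - jE ((u : Matrix (Fin 1) (Fin 1) E) 0 0))) / jE ϖ := by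
        rw [map_div₀, map_sub, map_one, hρϖ, map_sub, hρu]
        field_simp
        ring
      rw [e, Valuation.map_div, div_le_iff₀ hvjϖpos]
      exact hantile
  · exact isOrd_div_mul_of_deep hvρ hα hα1 jE hjv hϖ hρϖ hYO hYb hcb hμ hanti

/-- **HEAD — «A DEEP CONE CELL IS OFF THE SHELL», SHELL FORM (any `q`).**  Same letters: for EVERY square level `mc`, `¬ LatticeNearTransvShell ϖ 0 mc (Γ − 1) L`.  At `d` even
(`ℓ₀ = 0`) both labels `Q₊`, `Q₋` of ★ p861305's cell currency are FALSE on every glued vertex over a deep cell (`2b < m₀`, `j + b < jl′`), which therefore pays `0` to the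
labelled difference (★ p861332 `natCast_finsum_sub_eq_zero_of_forall_not`) — the q-free half of «OFF-ROW ZERO».
[cite: Kottwitz1986BaseChangeUnits, §3] [cite: Rogawski1990, §4.9 Prop. 4.9.1 (b) p. 55] [cite: Serre1979, Ch. III §6 Prop. 12] -/
theorem not_latticeNearTransvShell_zero_of_deep
    (hvρ : ∀ x, Valued.v (ρ x) = Valued.v x) (hα : ρ α ≠ α) (hα1 : Valued.v α ≤ 1)
    {ϖ : E} (hϖ : Valued.v ϖ = exp (-1 : ℤ))
    (jE : E →+* M) (hjv : ∀ c, Valued.v (jE c) ≤ 1 ↔ Valued.v c ≤ 1) (hjfix : ∀ z, ρ z = z ↔ ∃ c, jE c = z)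
    (φ : (Fin 2 → E) →+ M) (hφs : ∀ (c : E) (x : Fin 2 → E), φ (c • x) = jE c * φ x) (hφi : Function.Injective φ)
    {γ₂ : GL (Fin 2) E} {lam : M} (hφγ : ∀ x, φ ((γ₂ : Matrix (Fin 2) (Fin 2) E) *ᵥ x) = lam * φ x)
    {L : Submodule 𝒪[E] (Fin 3 → E)} {b : ℕ} (hb : ∀ a : E, (Pi.single 1 a : Fin 3 → E) ∈ L ↔ Valued.v a ≤ Valued.v ϖ ^ b)
    (hpr : ∀ x ∈ L, Valued.v (x 1) * Valued.v ϖ ^ b ≤ 1)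
    {B₂ : Submodule 𝒪[E] (Fin 2 → E)} {w₀ : Fin 2 → E} {g₀ : Fin 3 → E}
    (hB : B₂.map ((Matrix.toLin' (!![1, 0; 0, 0; 0, 1] : Matrix (Fin 3) (Fin 2) E)).restrictScalars 𝒪[E]) =
      L ⊓ LinearMap.ker ((LinearMap.proj (1 : Fin 3) : (Fin 3 → E) →ₗ[E] E).restrictScalars 𝒪[E]))
    (hg₀ : g₀ ∈ L) (hg₀1 : Valued.v (g₀ 1) * Valued.v ϖ ^ b = 1) (hprg : g₀ - Pi.single 1 (g₀ 1) = ![w₀ 0, 0, w₀ 1])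
    {Λ : AddSubgroup M} (hBΛ : B₂.toAddSubgroup.map φ = Λ) {cc x₀ Y : M} (hx₀ : x₀ ≠ 0)
    (hΛx : ∀ x, x ∈ Λ ↔ ∃ z, IsOrd ρ α cc z ∧ x = x₀ * z) (hw₀Y : φ w₀ = Y⁻¹ * x₀)
    (hYO : IsOrd ρ α cc Y) (hYb : Valued.v Y = Valued.v (jE ϖ) ^ b) (hcb : Valued.v cc ≤ Valued.v (jE ϖ) ^ b)
    (u : GL (Fin 1) E) {m : ℕ} (hm1 : 1 ≤ m) (hum : Valued.v ((u : Matrix (Fin 1) (Fin 1) E) 0 0 - 1) ≤ Valued.v (ϖ ^ m))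
    (hμ : Valued.v (lam - jE ((u : Matrix (Fin 1) (Fin 1) E) 0 0)) ≤ Valued.v (jE ϖ) ^ (2 * b + 1))
    (hanti : Valued.v ((lam - jE ((u : Matrix (Fin 1) (Fin 1) E) 0 0)) - ρ (lam - jE ((u : Matrix (Fin 1) (Fin 1) E) 0 0))) ≤
      Valued.v (cc * (α - ρ α)) * Valued.v (jE ϖ) ^ (b + 1)) (mc : ℕ) :
    ¬ LatticeNearTransvShell ϖ 0 mc ((((endoGL (γ₂, u) : GL (Fin 3) E) : Matrix (Fin 3) (Fin 3) E) - 1)) L := fun h =>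
  h.2.1 (latticeInLevel_one_endoGL_sub_one_of_deep hvρ hα hα1 hϖ jE hjv hjfix φ hφs hφi hφγ hb hpr hB hg₀ hg₀1 hprg hBΛ hx₀ hΛx hw₀Y hYO hYb hcb u hm1 hum
    hμ hanti)

end Summit.HodgeConjecture.HodgeConjecture.Cruxes.H413.F0P3cDyRamDeepConeCellOffShell

end
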